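import Summits.CriticalPhenomena.SAWScalingLimit.Theorems.SAWLeftRightFKGLeftRightFKGReduction
import Summits.CriticalPhenomena.SAWScalingLimit.Theorems.SAWLeftRightFKGLeftRightFKGStubClassDictionary
import Summits.CriticalPhenomena.SAWScalingLimit.Theorems.SAWLeftRightFKGLeftRightFKGStubAllMeetProportional
import Summits.CriticalPhenomena.SAWScalingLimit.Theorems.SAWLeftRightFKGLeftRightFKGStubCornerQuadruple
import Summits.CriticalPhenomena.SAWScalingLimit.Theorems.SAWLeftRightFKGLeftRightFKGStubCornerAssembly
import Summits.CriticalPhenomena.SAWScalingLimit.Theorems.SAWLeftRightFKGLeftRightFKGStubCornerContinuity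
import Summits.CriticalPhenomena.SAWScalingLimit.Theorems.SAWTotalPositivityBoundaryTP2Kernel
import HarnessLib

/-!
# `InterlacedTP2At x_c ⟹ LeftRightFKG`: the left–right FKG crux reduced to the sibling core (line `corner-localisation`, lead c1)

Crux `Summit.CriticalPhenomena.SAWScalingLimit.Theses.SAWLeftRightFKG.LeftRightFKG` (stmt-CriticalPhenomena-11232):
left–right positive association of the critical square-lattice SAW chord measure in a simply connected lattice domain
between boundary-adjacent endpoints. This file composes the landed pieces of line `corner-localisation`:

* lead 0: `CornerLoc.stub_reduction : CornerCritical → LeftRightFKG` (p98583) — fugacity-blind Harris/CIS reduction to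
  corner positivity of all slit sub-instances;
* lead c1 (reshape v5): `stub_classDictionary` (p124310), `stub_allMeetProportional` (p123983), `stub_cornerQuadruple`
  (p124147), `stub_cornerAssembly` — corner positivity at `x` from the interlacing-only TP₂ of the fugacity-`x`
  self-avoiding path kernel on finite subgraphs of `ℤ²` (`BoundaryTP2.InterlacedTP2At x`, vocabulary of the sibling crux
  `SAWTotalPositivity.BoundaryTP2`, stmt-CriticalPhenomena-7115); `stub_cornerContinuity` (p123939).

Results:
* `cornerCritical_of_interlacedTP2At` : `InterlacedTP2At x_c → CornerCritical`;
* `corner_of_interlacedTP2At`          : `0 < x → InterlacedTP2At x → Corner x` (every fugacity);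
* `leftRightFKG_of_interlacedTP2At`    : `InterlacedTP2At x_c → LeftRightFKG` (registered sub-goal `stub_transfer`);
* `leftRightFKG_of_subcritical`        : `(∀ 0 < x < x_c, InterlacedTP2At x) → LeftRightFKG` (the open content sits in
  the subcritical regime, where every finite instance is a decidable statement over `ℚ`).

So the crux is a kernel-checked consequence of ONE named open statement, `BoundaryTP2.InterlacedTP2At x_c`, which also
implies the sibling crux (`BoundaryTP2.graphTP2At_of_interlacedTP2At`, `boundaryTP2_of_graphTP2At`, landed). That
statement is a new conjecture, not in print (0 violations on ≈ 1.2·10⁹ enumerated instances; asymptotically tight; false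
at every `x > x_c` by `BoundaryTP2.not_graphTP2At_of_criticalFugacity_lt`).
-/

noncomputable section

open Literature.Probability.LatticeModels Literature.Probability.RandomPlanarGeometry

namespace Summit.CriticalPhenomena.SAWScalingLimit.Theorems.LeftRightFKG.CornerLoc

/-- CORNER POSITIVITY AT EVERY FUGACITY from the interlacing-only TP₂ at that fugacity. [folklore] -/
theorem corner_of_interlacedTP2At {x : ℝ} (hx : 0 < x) (h : BoundaryTP2.InterlacedTP2At x) : Corner x :=
  CornerAssembly.corner_of_parts hx stub_classDictionary (stub_allMeetProportional x hx) (stub_cornerQuadruple x hx h)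

/-- CORNER POSITIVITY AT `x_c` from the critical interlacing-only TP₂. [folklore] -/
theorem cornerCritical_of_interlacedTP2At (h : BoundaryTP2.InterlacedTP2At SAW.criticalFugacity) : CornerCritical :=
  stub_cornerAssembly stub_classDictionary stub_allMeetProportional stub_cornerQuadruple h

/-- **THE CRUX FROM THE SIBLING CORE**: the interlacing-only boundary TP₂ of the critical self-avoiding path kernel on
finite subgraphs of `ℤ²` implies left–right positive association of the critical SAW chord measure in every simply
connected lattice domain between boundary-adjacent endpoints. [folklore] -/
theorem leftRightFKG_of_interlacedTP2At (h : BoundaryTP2.InterlacedTP2At SAW.criticalFugacity) :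
    Summit.CriticalPhenomena.SAWScalingLimit.Theses.SAWLeftRightFKG.LeftRightFKG :=
  stub_reduction (cornerCritical_of_interlacedTP2At h)

/-- THE CRUX FROM THE SUBCRITICAL CORE: interlacing-only TP₂ at every fugacity `0 < x < x_c` already implies the crux
(corner positivity is closed from below in the fugacity, `stub_cornerContinuity`). [folklore] -/
theorem leftRightFKG_of_subcritical (h : ∀ x : ℝ, 0 < x → x < SAW.criticalFugacity → BoundaryTP2.InterlacedTP2At x) :
    Summit.CriticalPhenomena.SAWScalingLimit.Theses.SAWLeftRightFKG.LeftRightFKG :=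
  stub_reduction (stub_cornerContinuity fun x hx hxc => corner_of_interlacedTP2At hx (h x hx hxc))

/-- REGISTERED SUB-GOAL `stub_transfer` (recorded on the crux item so that this composition lands as a `--supports`
proof): `InterlacedTP2At x_c → LeftRightFKG`. [folklore] -/
theorem stub_transfer : BoundaryTP2.InterlacedTP2At SAW.criticalFugacity →
    Summit.CriticalPhenomena.SAWScalingLimit.Theses.SAWLeftRightFKG.LeftRightFKG :=
  leftRightFKG_of_interlacedTP2At

end Summit.CriticalPhenomena.SAWScalingLimit.Theorems.LeftRightFKG.CornerLoc

end
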